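import Summits.Parity.BatemanHorn.Theorems.SoloInformedRootPairProfile
import Summits.Parity.BatemanHorn.Theorems.SoloInformedRootPairCRT
import Literature.NumberTheory.Sieve.PolynomialCongruencesProofs

/-!
# Calibration: at every FIXED scale the profile hypotheses are theorems (Hooley 1964)

Informed soloist `solo-Parity-informed` (session 144), conjunct `BatemanHorn`, the `d ≥ 3` rung BELOW the parity
wall.  The sufficient conditions for Erdős's cubic asymptotic typed in this line — the `ℓ¹` scale profile
`HooleyMeanProfile g θ η` (`SoloInformedHooleyMeanProfile`) and its second-moment / pair-correlation forms
(`SoloInformedRootPairProfile`) — ask, on every dyadic range of moduli `(E, E']` and every scale `H ≤ E^θ`,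
`∑_{1≤|h|≤H} |T(h)| ≤ ε·E + C·H·E^{1−η}` (`T(h) = ∑_{E<e≤E'} S_g(h;e)`), resp.
`PS(H) ≤ N² + ε·E²/H + C·H·E^{2(1−η)}`.  This file records, in the kernel, that their content at any FIXED scale is
KNOWN: by Hooley's theorem on the roots of polynomial congruences (1964) — `∑_{k≤x} S_g(h;k) = o(x)` for every
irreducible `g` of degree `≥ 2` and every `h ≠ 0`, PROVED in the tree as
`Literature.NumberTheory.Sieve.hooley_polyRoots_equidistributed_holds` — for every fixed `H`,

* `sum_norm_hooleySum_fixedScale_le`: `∑_{1≤h≤H}(|T(h)| + |T(−h)|) ≤ ε·E` for `E ≥ E₀(ε, H)`, `E ≤ E' ≤ 2E`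
  (the `ℓ¹` profile inequality with `C = 0`);
* `rootPairSum_fixedScale_le`: `PS(H) ≤ N² + ε·E²` for `E ≥ E₀(ε, H)` (the pair-correlation profile inequality with
  `C = 0`: at a fixed scale `1/H` the Fejér pair count of the root fractions is the uniform prediction `N²` up to
  `o(E²)`).

So the OPEN content of the hypotheses is exactly the growth of the scale with the modulus — the mean saving
factor `≍ min(H, E^η)` for `H = H(E) → ∞` (up to `E^θ`, `θ > 2/3` for cubics) — and nothing at bounded scales.
No rate and no uniformity in `h` is imported: the tree's Hooley theorem is used only as `o(x)` for each `h`.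
-/

namespace Summit.Parity.BatemanHorn.Theorems

open Finset Polynomial Filter Asymptotics
open Literature.NumberTheory.Sieve (polyRootWeylSum hooley_polyRoots_equidistributed_holds
  hooley_polyRoots_equidistributed_iff)

/-! ### One frequency: Hooley's `o(x)` on dyadic ranges -/

/-- `Icc 1 N = Ioc 0 N` in `ℕ`. [folklore] -/
private theorem Icc_one_eq_Ioc_zero' (N : ℕ) : Icc 1 N = Ioc 0 N := by
  ext x; simp only [mem_Icc, mem_Ioc]; omega

/-- **Hooley 1964 on dyadic ranges, one frequency.**  For `g` irreducible of degree `≥ 2` and `h ≠ 0`: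
for every `ε > 0`, eventually in `E`, `‖∑_{E<e≤E'} S_g(h;e)‖ ≤ ε·E` for all `E ≤ E' ≤ 2E`.
[Hooley 1964, via `Literature.NumberTheory.Sieve.hooley_polyRoots_equidistributed_holds`; this work] -/
theorem eventually_norm_sum_Ioc_hooleySum_le {g : ℤ[X]} (hirr : Irreducible g) (hdeg : 2 ≤ g.natDegree)
    {h : ℤ} (hh : h ≠ 0) {ε : ℝ} (hε : 0 < ε) :
    ∀ᶠ E : ℕ in atTop, ∀ E' : ℕ, E ≤ E' → E' ≤ 2 * E → ‖∑ e ∈ Ioc E E', hooleySum g e h‖ ≤ ε * E := by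
  have hH := (hooley_polyRoots_equidistributed_iff.mp hooley_polyRoots_equidistributed_holds) g hdeg hirr h hh
  have hev := hH.def (show (0 : ℝ) < ε / 3 by positivity)
  obtain ⟨N₀, hN₀⟩ := eventually_atTop.mp hev
  refine eventually_atTop.mpr ⟨N₀, fun E hE E' hEE' hE'2 => ?_⟩
  have h1 := hN₀ E hE
  have h2 := hN₀ E' (hE.trans hEE')
  rw [Real.norm_natCast] at h1 h2
  have hsplit : ∑ e ∈ Ioc E E', hooleySum g e h =
      ∑ e ∈ Icc 1 E', polyRootWeylSum g e h - ∑ e ∈ Icc 1 E, polyRootWeylSum g e h := by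
    rw [Icc_one_eq_Ioc_zero', Icc_one_eq_Ioc_zero', ← sum_Ioc_consecutive _ (Nat.zero_le E) hEE']
    simp only [hooleySum_eq_polyRootWeylSum, add_sub_cancel_left]
  have hE'r : (E' : ℝ) ≤ 2 * E := by exact_mod_cast hE'2
  calc ‖∑ e ∈ Ioc E E', hooleySum g e h‖
      ≤ ‖∑ e ∈ Icc 1 E', polyRootWeylSum g e h‖ + ‖∑ e ∈ Icc 1 E, polyRootWeylSum g e h‖ := by
        rw [hsplit]; exact norm_sub_le _ _
    _ ≤ ε / 3 * E' + ε / 3 * E := add_le_add h2 h1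
    _ ≤ ε * E := by nlinarith

/-- **All frequencies of a fixed finite range at once.** [this work] -/
theorem eventually_forall_norm_sum_Ioc_hooleySum_le {g : ℤ[X]} (hirr : Irreducible g)
    (hdeg : 2 ≤ g.natDegree) (H : ℕ) {ε : ℝ} (hε : 0 < ε) :
    ∀ᶠ E : ℕ in atTop, ∀ E' : ℕ, E ≤ E' → E' ≤ 2 * E → ∀ h ∈ Icc 1 H,
      ‖∑ e ∈ Ioc E E', hooleySum g e h‖ ≤ ε * E ∧ ‖∑ e ∈ Ioc E E', hooleySum g e (-(h : ℤ))‖ ≤ ε * E := by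
  have hall : ∀ h ∈ Icc 1 H, ∀ᶠ E : ℕ in atTop, ∀ E' : ℕ, E ≤ E' → E' ≤ 2 * E →
      ‖∑ e ∈ Ioc E E', hooleySum g e h‖ ≤ ε * E ∧ ‖∑ e ∈ Ioc E E', hooleySum g e (-(h : ℤ))‖ ≤ ε * E := by
    intro h hh
    have h1 : 1 ≤ h := (mem_Icc.mp hh).1
    have hne : (h : ℤ) ≠ 0 := by exact_mod_cast (show h ≠ 0 by omega)
    have hne' : (-(h : ℤ)) ≠ 0 := neg_ne_zero.mpr hne
    filter_upwards [eventually_norm_sum_Ioc_hooleySum_le hirr hdeg hne hε,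
      eventually_norm_sum_Ioc_hooleySum_le hirr hdeg hne' hε] with E hA hB E' hEE' hE'
    exact ⟨hA E' hEE' hE', hB E' hEE' hE'⟩
  filter_upwards [(eventually_all_finset (Icc 1 H)).mpr hall] with E hE E' hEE' hE' h hh
  exact hE h hh E' hEE' hE'

/-! ### The `ℓ¹` profile inequality at a fixed scale -/

/-- **Calibration of the `ℓ¹` profile at fixed scale (unconditional).**  For `g` irreducible of degree `≥ 2`
and every fixed `H`: for every `ε > 0` there is `E₀` with
`∑_{1≤h≤H}(‖T(h)‖ + ‖T(−h)‖) ≤ ε·E` for all `E₀ ≤ E ≤ E' ≤ 2E` — the inequality of `HooleyMeanProfile`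
with `C = 0`, at bounded scales.  [Hooley 1964; this work] -/
theorem sum_norm_hooleySum_fixedScale_le {g : ℤ[X]} (hirr : Irreducible g) (hdeg : 2 ≤ g.natDegree)
    (H : ℕ) {ε : ℝ} (hε : 0 < ε) :
    ∃ E₀ : ℕ, ∀ E E' : ℕ, E₀ ≤ E → E ≤ E' → E' ≤ 2 * E →
      ∑ h ∈ Icc 1 H, (‖∑ e ∈ Ioc E E', hooleySum g e h‖ + ‖∑ e ∈ Ioc E E', hooleySum g e (-(h : ℤ))‖)
        ≤ ε * E := by
  rcases Nat.eq_zero_or_pos H with rfl | hHpos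
  · refine ⟨0, fun E E' _ _ _ => ?_⟩
    rw [show Icc 1 0 = (∅ : Finset ℕ) by rfl, sum_empty]; positivity
  have hδ : 0 < ε / (2 * H) := by positivity
  obtain ⟨E₀, hE₀⟩ := eventually_atTop.mp (eventually_forall_norm_sum_Ioc_hooleySum_le hirr hdeg H hδ)
  refine ⟨E₀, fun E E' h0 hEE' hE' => ?_⟩
  have key := hE₀ E h0 E' hEE' hE'
  calc ∑ h ∈ Icc 1 H, (‖∑ e ∈ Ioc E E', hooleySum g e h‖ + ‖∑ e ∈ Ioc E E', hooleySum g e (-(h : ℤ))‖)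
      ≤ ∑ h ∈ Icc 1 H, (ε / (2 * H) * E + ε / (2 * H) * E) :=
        sum_le_sum fun h hh => add_le_add (key h hh).1 (key h hh).2
    _ = ε * E := by
        rw [sum_const, Nat.card_Icc, nsmul_eq_mul]; push_cast
        have hHr : (0 : ℝ) < H := by exact_mod_cast hHpos
        field_simp; ring

/-! ### The pair-correlation profile inequality at a fixed scale -/

/-- **Calibration of the pair-correlation profile at fixed scale (unconditional).**  For `g` irreducible of
degree `≥ 2` and every fixed `H`: for every `ε > 0` there is `E₀` with
`rootPairSum g E E' H ≤ N² + ε·E²` for all `E₀ ≤ E ≤ E' ≤ 2E` — at a fixed scale `1/H` the Fejér pair count of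
the root fractions `ν/e`, `E < e ≤ E'`, exceeds the uniform prediction `N²` by `o(E²)`; the inequality of
`HooleyPairCorrelationProfile` with `C = 0`, at bounded scales.  [Hooley 1964; this work] -/
theorem rootPairSum_fixedScale_le {g : ℤ[X]} (hirr : Irreducible g) (hdeg : 2 ≤ g.natDegree)
    (H : ℕ) {ε : ℝ} (hε : 0 < ε) :
    ∃ E₀ : ℕ, ∀ E E' : ℕ, E₀ ≤ E → E ≤ E' → E' ≤ 2 * E →
      rootPairSum g E E' H ≤ (#(rootPoints g E E') : ℝ) ^ 2 + ε * (E : ℝ) ^ 2 := by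
  rcases Nat.eq_zero_or_pos H with rfl | hHpos
  · refine ⟨0, fun E E' _ _ _ => ?_⟩
    have h1 := rootPairSum_sub_sq_le g E E' 0
    rw [show Icc 1 0 = (∅ : Finset ℕ) by rfl, sum_empty] at h1
    have : 0 ≤ ε * (E : ℝ) ^ 2 := by positivity
    linarith
  have hδ : 0 < Real.sqrt (ε / (2 * H)) := Real.sqrt_pos.mpr (by positivity)
  obtain ⟨E₀, hE₀⟩ := eventually_atTop.mp (eventually_forall_norm_sum_Ioc_hooleySum_le hirr hdeg H hδ)
  refine ⟨E₀, fun E E' h0 hEE' hE' => ?_⟩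
  have key := hE₀ E h0 E' hEE' hE'
  have hsq : Real.sqrt (ε / (2 * H)) ^ 2 = ε / (2 * H) := Real.sq_sqrt (by positivity)
  have hb : ∀ h ∈ Icc 1 H, ‖∑ e ∈ Ioc E E', hooleySum g e h‖ ^ 2 +
      ‖∑ e ∈ Ioc E E', hooleySum g e (-(h : ℤ))‖ ^ 2 ≤ 2 * (ε / (2 * H) * (E : ℝ) ^ 2) := by
    intro h hh
    have h1 : ‖∑ e ∈ Ioc E E', hooleySum g e h‖ ^ 2 ≤ (Real.sqrt (ε / (2 * H)) * E) ^ 2 :=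
      pow_le_pow_left₀ (norm_nonneg _) (key h hh).1 2
    have h2 : ‖∑ e ∈ Ioc E E', hooleySum g e (-(h : ℤ))‖ ^ 2 ≤ (Real.sqrt (ε / (2 * H)) * E) ^ 2 :=
      pow_le_pow_left₀ (norm_nonneg _) (key h hh).2 2
    rw [mul_pow, hsq] at h1 h2
    linarith
  have hsum := rootPairSum_sub_sq_le g E E' H
  have hHr : (0 : ℝ) < H := by exact_mod_cast hHpos
  have htot : ∑ h ∈ Icc 1 H, (‖∑ e ∈ Ioc E E', hooleySum g e h‖ ^ 2 +
      ‖∑ e ∈ Ioc E E', hooleySum g e (-(h : ℤ))‖ ^ 2) ≤ ε * (E : ℝ) ^ 2 := by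
    calc _ ≤ ∑ h ∈ Icc 1 H, 2 * (ε / (2 * H) * (E : ℝ) ^ 2) := sum_le_sum hb
      _ = ε * (E : ℝ) ^ 2 := by
          rw [sum_const, Nat.card_Icc, nsmul_eq_mul]; push_cast
          field_simp
  linarith

/-- **In words (the calibration).**  For every irreducible `g` of degree `≥ 2` and every fixed scale `H`, both
profile inequalities hold eventually with the power term absent: the hypotheses `HooleyMeanProfile g θ η` /
`HooleyPairCorrelationProfile g θ η` restricted to `H ≤ H₀` (any fixed `H₀`) are theorems.  Packaged as one
statement for the `ℓ¹` form with a uniform `E₀` over `H ≤ H₀`. [this work] -/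
theorem sum_norm_hooleySum_boundedScales_le {g : ℤ[X]} (hirr : Irreducible g) (hdeg : 2 ≤ g.natDegree)
    (H₀ : ℕ) {ε : ℝ} (hε : 0 < ε) :
    ∃ E₀ : ℕ, ∀ E E' H : ℕ, E₀ ≤ E → E ≤ E' → E' ≤ 2 * E → H ≤ H₀ →
      ∑ h ∈ Icc 1 H, (‖∑ e ∈ Ioc E E', hooleySum g e h‖ + ‖∑ e ∈ Ioc E E', hooleySum g e (-(h : ℤ))‖)
        ≤ ε * E := by
  obtain ⟨E₀, hE₀⟩ := sum_norm_hooleySum_fixedScale_le hirr hdeg H₀ hε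
  refine ⟨E₀, fun E E' H h0 hEE' hE' hH => (sum_le_sum_of_subset_of_nonneg
    (Icc_subset_Icc_right hH) fun h _ _ => by positivity).trans (hE₀ E E' h0 hEE' hE')⟩

end Summit.Parity.BatemanHorn.Theorems
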